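import Summits.Ventures.PercRepro.Night2LocalDQm1Rows
import Summits.Ventures.PercRepro.Night2LocalD2R14SixZeroN
import Summits.Ventures.PercRepro.Night2LocalD3KOne
import Summits.Ventures.PercRepro.Night2LocalD3KTwo
import Summits.Ventures.PercRepro.Night2LocalD3ZeroFat
import Summits.Ventures.PercRepro.Night2LocalD3Coloops
import Summits.Ventures.PercRepro.Night2LocalD2KZero
import Summits.Ventures.PercRepro.Night2LocalD2KOneSplit

/-!
# PercRepro — THE `q = 4` LEG OF THE `(7, 5)` ROW (night-2, gen 17)

The `(7, 5)` shadow row was reduced (Night2LocalDQm1Rows, `shadowHall_seven_five_of_local`) to the local forms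
(LI_G) of loopless simple rank-`6` matroids at the hyperplanes with `2 ≤ |E ∖ G| ≤ 3` (the `q = 4` leg) and of
loopless simple rank-`7` matroids at the hyperplanes with `2 ≤ |E ∖ G| ≤ 4` (the `q = 5` leg).  The `q = 4` leg is
now a tree theorem cell by cell (the `(6, 4)` row, gens 12–16): `|E ∖ G| = 2` with `kColoops = 0`
(`localShadowHall_d2_of_kColoops_eq_zero`), `= 1` (`localShadowHall_d2_of_kColoops_eq_one` + Case A
`localShadowHall_caseA`), `≥ 2` (`localShadowHall_of_card_le_kColoops`); `|E ∖ G| = 3` with `kColoops = 0`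
(`localShadowHall_d3_zero`), `= 1` (`localShadowHall_d3_k1`), `= 2` (`localShadowHall_d3_k2`), `≥ 3`
(`localShadowHall_d3_of_three_le_kColoops`).

**`localShadowHall_four_of_two_three`** assembles them, and **`shadowHall_seven_five_of_local_five`** states the
`(7, 5)` row for every finite matroid modulo the `q = 5` leg alone — the exact open set of the row: the eight
cells `(|E ∖ G|, kColoops) ∈ {(2,0), (2,1), (3,0), (3,1), (3,2), (4,1), (4,2), (4,3)}` of loopless simple rank-`7`
matroids (the other cells of the `q = 5` leg are in the tree: `kColoops ≥ |E ∖ G|` and `|E ∖ G| = 4` without a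
coloop, Theorem F).
-/

namespace PercRepro.Shadow

open Finset PerFlat ThmH

variable {α : Type*} [DecidableEq α] {M : Matroid α} [M.Finite]

open scoped Classical in
/-- **THE `q = 4` LEG OF THE `(7, 5)` ROW**: for a loopless simple matroid and a rank-`5` flat `G` with
`2 ≤ |E ∖ G| ≤ 3`, the local form (LI_G) at `q = 4` holds — every coloop count of `M|G`. -/
theorem localShadowHall_four_of_two_three {G : Finset α}
    (hs : ∀ e ∈ gr M, ∀ f ∈ gr M, e ≠ f → rkN M {e, f} = 2) (hl : ∀ e ∈ gr M, M.Indep {e})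
    (hG : G ∈ flatsQ M (4 + 1)) (h2 : 2 ≤ (gr M \ G).card) (h3 : (gr M \ G).card ≤ 3) :
    LocalShadowHall M 4 G := by
  rcases Nat.lt_or_ge (gr M \ G).card 3 with hd | hd
  · -- `|E ∖ G| = 2`
    have hd2 : (gr M \ G).card = 2 := by omega
    rcases Nat.lt_or_ge (kColoops M G) 2 with hk | hk
    · rcases Nat.lt_or_ge (kColoops M G) 1 with hk0 | hk1
      · exact localShadowHall_d2_of_kColoops_eq_zero hG hd2 (by omega)
      · have hk1' : kColoops M G = 1 := by omega
        exact localShadowHall_d2_of_kColoops_eq_one hG hk1'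
          (fun y hy hyc _ => localShadowHall_caseA hG hd2 hs hk1' hy hyc)
    · exact localShadowHall_of_card_le_kColoops hG hd2 (by omega) hk
  · -- `|E ∖ G| = 3`
    have hd3 : (gr M \ G).card = 3 := by omega
    rcases Nat.lt_or_ge (kColoops M G) 3 with hk | hk
    · rcases Nat.lt_or_ge (kColoops M G) 1 with hk0 | hk1
      · exact localShadowHall_d3_zero hs hl hG hd3 (by omega)
      · rcases Nat.lt_or_ge (kColoops M G) 2 with hk1' | hk2
        · exact localShadowHall_d3_k1 hs hl hG hd3 (by omega)
        · exact localShadowHall_d3_k2 hs hl hG hd3 (by omega)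
    · exact localShadowHall_d3_of_three_le_kColoops hG hd3 hk

section SevenFive

variable {α' : Type} [DecidableEq α']

/-- **THE `(7, 5)` SHADOW ROW FOR EVERY FINITE MATROID MODULO THE `q = 5` LEG ALONE**: if the local form (LI_G)
holds for loopless simple rank-`7` matroids at every rank-`6` flat `G` with `2 ≤ |E ∖ G| ≤ 4`,
`kColoops + 1 ≤ |E ∖ G|` and `kColoops ≥ |E ∖ G| − 3` (the eight cells `(2,0) (2,1) (3,0) (3,1) (3,2) (4,1) (4,2)
(4,3)`), then `ShadowHall M 7 5 (phiK 7 5)` for every finite matroid `M`. -/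
theorem shadowHall_seven_five_of_local_five
    (hloc5 : ∀ (N : Matroid α') [N.Finite], (∀ e ∈ gr N, ∀ f ∈ gr N, e ≠ f → rkN N {e, f} = 2) →
      (∀ e ∈ gr N, N.Indep {e}) → N.eRank = ((5 + 2 : ℕ) : ℕ∞) →
      ∀ G ∈ flatsQ N (5 + 1), 2 ≤ (gr N \ G).card → (gr N \ G).card ≤ 4 →
        kColoops N G + 1 ≤ (gr N \ G).card → 1 ≤ kColoops N G + 4 - (gr N \ G).card → LocalShadowHall N 5 G)
    (M : Matroid α') [M.Finite] : ShadowHall M 7 5 (phiK 7 5) :=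
  shadowHall_seven_five_of_local_sharp
    (fun _ _ hs hl _ _ hG h2 h3 _ _ => localShadowHall_four_of_two_three hs hl hG h2 h3) hloc5 M

end SevenFive

end PercRepro.Shadow
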